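import Mathlib

/-!
# Splitting of `∫_{(0,∞)} h`: stub `stub_split` of the line `Sketch`
(crux stmt-RiemannHypothesis-16305, `SignCone.SignConeFarField`, route SignCone)

Pure measure-theoretic bookkeeping for the far-field majorant. With the split points
`t₁ = 4 log(15/14) < t₂ = 2 log(7/6) < L = log 2 < T = log 2001`, an `h` integrable on `(0, ∞)`
and pointwise minorants `h ≥ A·97/28` on `(0, t₁]`, `h ≥ A·279/100` on `[t₁, t₂]`, `h ≥ A·φ₃` on
`[t₂, ∞)` and `h ≥ A / sinh` on `[log 2, ∞)` (`A ≥ 0`), one has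
`∫_{(0,∞)} h ≥ A·(97/28·t₁ + 279/100·(t₂ − t₁) + ∫_{t₂}^{L} φ₃ + ∫_{L}^{T} dx / sinh x)`:
split `(0, ∞) = (0, t₁] ∪ (t₁, t₂] ∪ (t₂, L] ∪ (L, T] ∪ (T, ∞)` (`Set.Ioc_union_Ioi_eq_Ioi`,
`MeasureTheory.setIntegral_union`), bound each finite piece by `MeasureTheory.setIntegral_mono_on`
(constants via `MeasureTheory.setIntegral_const` / `Real.volume_real_Ioc_of_le`, the continuous
minorants via `ContinuousOn.integrableOn_Icc` and `intervalIntegral.integral_of_le`) and drop the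
non-negative tail (`MeasureTheory.setIntegral_nonneg`). Mathlib only.
-/

noncomputable section

-- `Summit.RiemannHypothesis.RiemannHypothesis.…` repeats a namespace component by design (D-0017 layout).
set_option linter.dupNamespace false

namespace Summit.RiemannHypothesis.RiemannHypothesis.Theorems.SignConeFarField

open MeasureTheory Set

/-- Splitting off a bounded piece: `∫_{(a,∞)} h = ∫_{(a,b]} h + ∫_{(b,∞)} h` for `0 ≤ a ≤ b` and `h`
integrable on `(0, ∞)`. -/
private theorem integral_Ioi_split {h : ℝ → ℝ} {a b : ℝ} (ha : 0 ≤ a) (hab : a ≤ b)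
    (hint : IntegrableOn h (Ioi 0)) :
    ∫ x in Ioi a, h x = (∫ x in Ioc a b, h x) + ∫ x in Ioi b, h x := by
  rw [← Ioc_union_Ioi_eq_Ioi hab, setIntegral_union (Ioc_disjoint_Ioi le_rfl) measurableSet_Ioi
    (hint.mono_set (Ioc_subset_Ioi_self.trans (Ioi_subset_Ioi ha)))
    (hint.mono_set (Ioi_subset_Ioi (ha.trans hab)))]

/-- A constant minorant `c ≤ h` on `(a, b]` gives `c·(b − a) ≤ ∫_{(a,b]} h`. -/
private theorem const_piece {h : ℝ → ℝ} {a b c : ℝ} (ha : 0 ≤ a) (hab : a ≤ b)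
    (hint : IntegrableOn h (Ioi 0)) (hle : ∀ x, a < x → x ≤ b → c ≤ h x) :
    c * (b - a) ≤ ∫ x in Ioc a b, h x := by
  have hI : IntegrableOn h (Ioc a b) :=
    hint.mono_set (Ioc_subset_Ioi_self.trans (Ioi_subset_Ioi ha))
  have h1 : ∫ _ in Ioc a b, c = c * (b - a) := by
    rw [setIntegral_const, Real.volume_real_Ioc_of_le hab, smul_eq_mul, mul_comm]
  rw [← h1]
  exact setIntegral_mono_on (integrableOn_const (by rw [Real.volume_Ioc]; exact ENNReal.ofReal_ne_top))
    hI measurableSet_Ioc (fun x hx => hle x hx.1 hx.2)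

/-- A continuous minorant `A·φ ≤ h` on `(a, b]` (`φ` continuous on `[a, b]`) gives
`A·∫_a^b φ ≤ ∫_{(a,b]} h`. -/
private theorem cont_piece {h φ : ℝ → ℝ} {A a b : ℝ} (ha : 0 ≤ a) (hab : a ≤ b)
    (hint : IntegrableOn h (Ioi 0)) (hφ : ContinuousOn φ (Icc a b))
    (hle : ∀ x, a < x → x ≤ b → A * φ x ≤ h x) :
    A * (∫ x in a..b, φ x) ≤ ∫ x in Ioc a b, h x := by
  have hI : IntegrableOn h (Ioc a b) :=
    hint.mono_set (Ioc_subset_Ioi_self.trans (Ioi_subset_Ioi ha))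
  have hφI : IntegrableOn φ (Ioc a b) :=
    (hφ.integrableOn_Icc (μ := volume)).mono_set Ioc_subset_Icc_self
  rw [intervalIntegral.integral_of_le hab, ← integral_const_mul]
  exact setIntegral_mono_on (Integrable.const_mul hφI A) hI measurableSet_Ioc
    (fun x hx => hle x hx.1 hx.2)

/-- **Stub `stub_split` (measure-theoretic splitting).** For `A ≥ 0`, `h` integrable on `(0, ∞)`
with the four pointwise minorants of the line `Sketch` on the pieces cut at
`t₁ = 4 log(15/14)`, `t₂ = 2 log(7/6)`, `log 2`, `log 2001`:
`A·(97/28·t₁ + 279/100·(t₂ − t₁) + ∫_{t₂}^{log 2} φ₃ + ∫_{log 2}^{log 2001} dx/sinh x) ≤ ∫_{(0,∞)} h`. -/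
theorem stub_split : ∀ (A : ℝ) (h : ℝ → ℝ), 0 ≤ A → IntegrableOn h (Set.Ioi 0) →
    (∀ x, 0 < x → x ≤ 4 * Real.log (15 / 14) → A * (97 / 28) ≤ h x) →
    (∀ x, 4 * Real.log (15 / 14) ≤ x → x ≤ 2 * Real.log (7 / 6) → A * (279 / 100) ≤ h x) →
    (∀ x, 2 * Real.log (7 / 6) ≤ x →
      A * (Real.exp (x / 2) / (Real.exp (x / 2) - 1) - 36 / 85 * (Real.exp (x / 2) * (Real.exp (x / 2) - 1)) -
        2 * Real.exp (x / 2) - 2 * Real.exp (-(x / 2))) ≤ h x) →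
    (∀ x, Real.log 2 ≤ x → A / Real.sinh x ≤ h x) →
    A * (97 / 28 * (4 * Real.log (15 / 14)) + 279 / 100 * (2 * Real.log (7 / 6) - 4 * Real.log (15 / 14)) +
        (∫ x in (2 * Real.log (7 / 6))..Real.log 2,
          (Real.exp (x / 2) / (Real.exp (x / 2) - 1) - 36 / 85 * (Real.exp (x / 2) * (Real.exp (x / 2) - 1)) -
            2 * Real.exp (x / 2) - 2 * Real.exp (-(x / 2)))) +
        ∫ x in Real.log 2..Real.log 2001, 1 / Real.sinh x) ≤
      ∫ x in Set.Ioi (0 : ℝ), h x := by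
  intro A h hA hint h1 h2 h3 h4
  -- order of the split points
  have ht₁ : 0 < 4 * Real.log (15 / 14) := by
    have := Real.log_pos (by norm_num : (1 : ℝ) < 15 / 14)
    linarith
  have e₁ : 4 * Real.log (15 / 14) = Real.log ((15 / 14) ^ 4) := by
    rw [Real.log_pow]; norm_num
  have e₂ : 2 * Real.log (7 / 6) = Real.log ((7 / 6) ^ 2) := by
    rw [Real.log_pow]; norm_num
  have h₁₂ : 4 * Real.log (15 / 14) ≤ 2 * Real.log (7 / 6) := by
    rw [e₁, e₂]; exact Real.log_le_log (by norm_num) (by norm_num)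
  have h₂L : 2 * Real.log (7 / 6) ≤ Real.log 2 := by
    rw [e₂]; exact Real.log_le_log (by norm_num) (by norm_num)
  have hLT : Real.log 2 ≤ Real.log 2001 := Real.log_le_log (by norm_num) (by norm_num)
  have hL : 0 < Real.log 2 := Real.log_pos (by norm_num)
  have ht₂ : 0 < 2 * Real.log (7 / 6) := ht₁.trans_le h₁₂
  -- the five pieces
  rw [integral_Ioi_split le_rfl ht₁.le hint, integral_Ioi_split ht₁.le h₁₂ hint,
    integral_Ioi_split ht₂.le h₂L hint, integral_Ioi_split hL.le hLT hint]
  have p1 := const_piece le_rfl ht₁.le hint h1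
  have p2 := const_piece ht₁.le h₁₂ hint (fun x hx hx' => h2 x hx.le hx')
  have p3 : A * (∫ x in (2 * Real.log (7 / 6))..Real.log 2,
      (Real.exp (x / 2) / (Real.exp (x / 2) - 1) - 36 / 85 * (Real.exp (x / 2) * (Real.exp (x / 2) - 1)) -
        2 * Real.exp (x / 2) - 2 * Real.exp (-(x / 2)))) ≤
      ∫ x in Ioc (2 * Real.log (7 / 6)) (Real.log 2), h x := by
    refine cont_piece ht₂.le h₂L hint ?_ (fun x hx _ => h3 x hx.le)
    intro x hx
    have hx0 : Real.exp (x / 2) - 1 ≠ 0 := by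
      have : 1 < Real.exp (x / 2) := Real.one_lt_exp_iff.2 (by linarith [hx.1])
      exact (sub_pos.2 this).ne'
    refine ContinuousAt.continuousWithinAt ?_
    fun_prop (disch := exact hx0)
  have p4 : A * (∫ x in Real.log 2..Real.log 2001, 1 / Real.sinh x) ≤
      ∫ x in Ioc (Real.log 2) (Real.log 2001), h x := by
    refine cont_piece hL.le hLT hint ?_ (fun x hx _ => ?_)
    · intro x hx
      have hx0 : Real.sinh x ≠ 0 := (Real.sinh_pos_iff.2 (hL.trans_le hx.1)).ne'
      refine ContinuousAt.continuousWithinAt ?_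
      fun_prop (disch := exact hx0)
    · rw [mul_one_div]
      exact h4 x hx.le
  have p5 : 0 ≤ ∫ x in Ioi (Real.log 2001), h x := by
    refine setIntegral_nonneg measurableSet_Ioi (fun x hx => ?_)
    have hx : Real.log 2001 < x := hx
    have hs : 0 < Real.sinh x := Real.sinh_pos_iff.2 (by linarith)
    exact (div_nonneg hA hs.le).trans (h4 x (by linarith))
  linarith

end Summit.RiemannHypothesis.RiemannHypothesis.Theorems.SignConeFarField

end
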